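import Literature.MathematicalPhysics.QuantumFieldTheory.ONArchipelagoSingletHead
import Literature.MathematicalPhysics.QuantumFieldTheory.ONArchipelagoVectorHead
import Literature.MathematicalPhysics.QuantumFieldTheory.ConformalBootstrap3D.CasimirRecursionPivots
import HarnessLib

/-!
# The external form of an `O(N)` archipelago point certificate from head numbers

Twelfth file of the archipelago rung.  Every row family of an archipelago point certificate already has
a closed-form kernel rule (`S`: `ONArchipelagoSingletTail` / `ONArchipelagoSingletHead`; `T`, `A`:
`ONArchipelagoTwoSign` / `ONArchipelagoTwoSignHead`; `V`: `ONArchipelagoVectorTail` /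
`ONArchipelagoVectorHead`); the one item of `ArchipelagoObligations` left to a direct check was the
EXTERNAL `2×2` form at the isolated points (item `ext`: `ExtPositive` at `(Δ_φ, Δ_s)`), which the
separate rows imply only when the gaps do not exclude `s`, `φ` (`extPositive_of_separate`) — and for a
genuine island they do (source §2.2: "If we did not impose a gap in the `S` and `V` sectors, the last two
constraints would imply the first").  This file gives the DIRECT rule.

The external form is `extForm = singletForm(g_s)(a,b) + a² · vectorForm_{ℓ=0}(g_φ^∓)` (the source's
`α⃗·(V⃗_{S,Δ_s,0} + V⃗_{V,Δ_φ,0} ⊗ (1 0; 0 0)) ⪰ 0`), i.e. the `2×2` form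
`a² (X_S(Δ_s) + V(Δ_φ)) + b² Y_S(Δ_s) + ab Z_S(Δ_s)`.  Both points `(Δ_s, 0)` and `(Δ_φ, 0)` are
scalars strictly above the unitarity bound, hence REGULAR (`not_accidentalDegeneracy3D_of_le_two`), so
both pieces have their pair-indexed `z`-series: the singlet form by `hasSum_singletForm_ofPoints`, the
`V` row — through the bridge `vectorForm = oddForm (toOdd α)`, `toOdd (ofPoints z z̄ w) = ofPoints z z̄
(oddWeights w)` and the domination `oddForm ≥ 𝔇` of the `σ–ε` odd chain — by
`hasSum_oddDomEval_ofPoints_pairs`.  Hence (`extPositive_ofPoints_of_heads`): if the JOINT head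
expression `Σ_{F_S} (A_{n,j}(Δ_s)/λ₀) q_{Δ_s+n,j}(a,b) + a² Σ_{F_V} (A^{AB}_{n,j}(Δ_φ)/λ₀) 𝔇[𝒫_{Δ_φ+n,j}]`
is `≥ 0` for all `(a,b)` and the terms off the two head sets are `≥ 0` (the tail rules (M_S)/(T_S),
(M_V)/(T_V) already in force for the rows), then `ExtPositive`.

On a box `Q ⊆ [φ_lo,φ_hi] × [s_lo,s_hi]` the head entries are enclosed by the SAME closed-form numbers
as the light cells — the singlet triple `singletHeadX/Y/Z` on the `Δ`-range `[s_lo, s_hi]` (spin `0`) and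
the `V` head number `vectorHeadNumber` on the `Δ`-range `[φ_lo, φ_hi]` (spin `0`) — and the `2×2` form is
PSD uniformly on `Q` as soon as `Y_lo ≥ 0`, `X_lo + U_lo ≥ 0`, `Z_abs² ≤ 4 (X_lo + U_lo) Y_lo`
(`extPositive_of_headNumbers`): FOUR numbers per certificate discharge the item `ext` — the `(1,1)`
entry may be carried by the `V` head number where the singlet `(1,1)` head sum alone is negative, which
is exactly the freedom a gapped functional uses.  With this file every item of `ArchipelagoObligations`
has a closed-form kernel rule.  No table, no number, no `sorry`.

Sources: arXiv:1504.07997 §2.2 (`KosPolandSimmonsDuffinVichi2015`); F. Kos, D. Poland,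
D. Simmons-Duffin, JHEP 11 (2014) 109, §3.3 eq. (3.16) (`KosPolandSimmonsduffin2014`); M. Hogervorst,
S. Rychkov, Phys. Rev. D 87 (2013) 106004, §3 eqs. (3.5), (3.9) (`HogervorstRychkov2013`);
D. Pappadopulo, S. Rychkov, J. Espin, R. Rattazzi, Phys. Rev. D 86 (2012) 105043, §5
(`PappadopuloRychkovEspinRattazzi2012`).
-/

noncomputable section

namespace Literature.MathematicalPhysics.QuantumFieldTheory.ONArchipelagoSystem

open Finset Set Filter Topology
open ConformalBootstrap3D (IsConformalBlock3D unitarityBound3D accidentalDegeneracy3D InDescendantRange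
  crossF CrossingFunctional pointFunctional zMono hrCoeff hrCoeffLo hrCoeffHi hrCoeffAB hrCoeffABLo
  hrCoeffABHi legendreLam legendreLam_pos hrCoeff_mem_Icc_interval hrCoeffAB_self_mem_Icc_interval
  hrCoeff_nonneg hrCoeff_eq_zero_of_not_inDescendantRange hrCoeffAB_self_nonneg
  hrCoeffAB_eq_zero_of_not_inDescendantRange headCellSumI headAbsSumI oddHeadCellSumI oddHeadNumber
  min_mul_le_mul_of_bounds quadForm_nonneg_of_det sum45_eq_twoWeightEval cornerBound₂ cornerBound₂_le
  termCornerBound termCornerBound_le apexRest headSet headSet_off natCast_add_half_le_unitarityBound3D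
  oddDomEval oddDomEval_le_oddForm_ofPoints hasSum_oddDomEval_ofPoints_pairs oddDomEval_eq_twoWeightEval
  oddDomEval_nonneg_of_apex not_accidentalDegeneracy3D_of_le_two)

namespace ArchipelagoFunctional

/-! ### The external form from a joint head and non-negative tails -/

/-- **External-form positivity from a joint head + non-negative tails, one point.** At an external
point with `Δ_φ, Δ_s` strictly above the scalar unitarity bound (`Δ_φ ≠ 1`): if the joint head expression
`Σ_{q ∈ F_S} (A_q(Δ_s)/λ₀) q_{Δ_s+n,j}(a,b) + a² Σ_{q ∈ F_V} (A^{AB}_q(Δ_φ)/λ₀) 𝔇[𝒫_{Δ_φ+n,j}]` is `≥ 0`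
for all `(a, b)`, every singlet term form off `F_S` on the descendant range is PSD and every dominated
`V` term off `F_V` on the descendant range is `≥ 0`, then `ExtPositive` at `(Δ_φ, Δ_s)` — for EVERY
triple of genuine blocks (both points are regular, `not_accidentalDegeneracy3D_of_le_two`).
[cite: KosPolandSimmonsDuffinVichi2015, §2.2 (OPE-coefficient symmetry)] -/
theorem extPositive_ofPoints_of_heads {N : ℕ} (z zb : Fin N → ℝ) (w : Fin 7 → Fin N → ℝ)
    (hz : ∀ k, z k ∈ Ioo (0 : ℝ) 1) (hzb : ∀ k, zb k ∈ Ioo (0 : ℝ) 1) {Δφ Δs : ℝ}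
    (hφ : unitarityBound3D 0 < Δφ) (hφ1 : Δφ ≠ 1) (hs : unitarityBound3D 0 < Δs)
    (FS FV : Finset (ℕ × ℕ))
    (hhead : ∀ a b : ℝ, 0 ≤ ∑ q ∈ FS, hrCoeff Δs 0 q.1 q.2 / legendreLam 0 *
        singletTermForm z zb w Δφ Δs (Δs + (q.1 : ℝ)) q.2 a b +
      a ^ 2 * ∑ q ∈ FV, hrCoeffAB ((Δφ - Δs) / 2) ((Δφ - Δs) / 2) Δφ 0 q.1 q.2 / legendreLam 0 *
        oddDomEval z zb (oddWeights w) Δφ (zMono (Δφ + (q.1 : ℝ)) q.2))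
    (htailS : ∀ q : ℕ × ℕ, q ∉ FS → InDescendantRange 0 q.1 q.2 →
      ∀ a b : ℝ, 0 ≤ singletTermForm z zb w Δφ Δs (Δs + (q.1 : ℝ)) q.2 a b)
    (htailV : ∀ q : ℕ × ℕ, q ∉ FV → InDescendantRange 0 q.1 q.2 →
      0 ≤ oddDomEval z zb (oddWeights w) Δφ (zMono (Δφ + (q.1 : ℝ)) q.2)) :
    (ofPoints z zb w).ExtPositive Δφ Δs := by
  intro gs gφm gφp hgs hgm hgp a b
  have hregs : ¬ accidentalDegeneracy3D Δs 0 := not_accidentalDegeneracy3D_of_le_two (by norm_num) hs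
  have hregφ : ¬ accidentalDegeneracy3D Δφ 0 := not_accidentalDegeneracy3D_of_le_two (by norm_num) hφ
  -- the singlet piece: head sum `≤ singletForm`
  have hS := hasSum_singletForm_ofPoints z zb w hz hzb hs hregs hgs Δφ Δs a b
  have hSle : ∑ q ∈ FS, hrCoeff Δs 0 q.1 q.2 / legendreLam 0 *
      singletTermForm z zb w Δφ Δs (Δs + (q.1 : ℝ)) q.2 a b ≤
      (ofPoints z zb w).singletForm Δφ Δs gs a b := by
    refine sum_le_hasSum FS (fun q hq => ?_) hS
    by_cases hr : InDescendantRange 0 q.1 q.2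
    · exact mul_nonneg (div_nonneg (hrCoeff_nonneg hs _ _) (legendreLam_pos 0).le) (htailS q hq hr a b)
    · rw [hrCoeff_eq_zero_of_not_inDescendantRange Δs hr, zero_div, zero_mul]
  -- the `V` piece: head sum `≤ 𝔇 ≤ oddForm = vectorForm`
  have hD := hasSum_oddDomEval_ofPoints_pairs z zb (oddWeights w) hz hzb Δφ (d := Δφ - Δs) hφ hregφ hgp
  have hVle : ∑ q ∈ FV, hrCoeffAB ((Δφ - Δs) / 2) ((Δφ - Δs) / 2) Δφ 0 q.1 q.2 / legendreLam 0 *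
      oddDomEval z zb (oddWeights w) Δφ (zMono (Δφ + (q.1 : ℝ)) q.2) ≤
      (ofPoints z zb w).vectorForm Δφ Δs 0 gφm gφp := by
    refine le_trans (sum_le_hasSum FV (fun q hq => ?_) hD) ?_
    · by_cases hr : InDescendantRange 0 q.1 q.2
      · exact mul_nonneg (div_nonneg (hrCoeffAB_self_nonneg _ hφ _ _) (legendreLam_pos 0).le)
          (htailV q hq hr)
      · rw [hrCoeffAB_eq_zero_of_not_inDescendantRange _ _ Δφ hr, zero_div, zero_mul]
    · rw [vectorForm_eq_oddForm, toOdd_ofPoints]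
      exact oddDomEval_le_oddForm_ofPoints z zb (oddWeights w) hz hzb hφ hregφ (fun _ => hφ1) hgm hgp
  have hV2 := mul_le_mul_of_nonneg_left hVle (sq_nonneg a)
  unfold extForm
  linarith [hhead a b, hSle, hV2]

/-! ### The external form on a box from four closed-form numbers -/

/-- **The item `ext` from head numbers.** In the dominated configuration (apex `a₀`), for
`(Δ_φ, Δ_s) ∈ Q ⊆ [φ_lo,φ_hi] × [s_lo,s_hi]` (`φ_lo, s_lo` strictly above the scalar unitarity bound,
`[φ_lo, φ_hi]` avoiding `1`, `(Δ_φ−Δ_s)/2 ∈ [c₁, c₂]` on `Q`), with the singlet tail rules (M_S) on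
`[E₀, E_T)` / (T_S) (apex numbers) and the `V` tail rules (M_V) / (T_V) in force (the SAME hypotheses as
the row rules `singletCell_of_headNumbers`, `vectorCell_of_headNumber`), head levels `n_S`, `n_V` with
`s_lo + n_S + 1 ≥ E₀`, `φ_lo + n_V + 1 ≥ E₀`, `τ ≤ s_lo`, `τ ≤ φ_lo`: the four numbers
`X_lo = singletHeadX (cell [s_lo,s_hi])`, `Y_lo = singletHeadY`, `Z_abs = singletHeadZ`,
`U_lo = vectorHeadNumber (cell [φ_lo,φ_hi])` with `Y_lo ≥ 0`, `X_lo + U_lo ≥ 0`,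
`Z_abs² ≤ 4 (X_lo + U_lo) Y_lo` give `ExtPositive` at every `p ∈ Q`.
[cite: KosPolandSimmonsDuffinVichi2015, §2.2 (OPE-coefficient symmetry); KosPolandSimmonsduffin2014, §3.3 eq. (3.16)] -/
theorem extPositive_of_headNumbers {N : ℕ} (z zb : Fin N → ℝ) (w : Fin 7 → Fin N → ℝ)
    (hz : ∀ k, z k ∈ Ioo (0 : ℝ) 1) (hzb : ∀ k, zb k ∈ Ioo (0 : ℝ) 1) (hord : ∀ k, zb k ≤ z k)
    (a₀ : Fin N) (qd qr : Fin N → ℝ) (hqd : ∀ k, 0 < qd k ∧ qd k ≤ 1)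
    (hqr : ∀ k, 0 < qr k ∧ qr k ≤ 1)
    (hdomd : ∀ k, z k * zb k ≤ qd k ^ 2 * (z a₀ * zb a₀) ∧ z k ≤ qd k * z a₀)
    (hdomr : ∀ k, (1 - z k) * (1 - zb k) ≤ qr k ^ 2 * (z a₀ * zb a₀) ∧ 1 - zb k ≤ qr k * z a₀)
    {Q : Set (ℝ × ℝ)} {φlo φhi slo shi c₁ c₂ E₀ ET τ : ℝ}
    (hQ : ∀ p ∈ Q, (φlo ≤ p.1 ∧ p.1 ≤ φhi) ∧ (slo ≤ p.2 ∧ p.2 ≤ shi))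
    (hQc : ∀ p ∈ Q, c₁ ≤ (p.1 - p.2) / 2 ∧ (p.1 - p.2) / 2 ≤ c₂)
    (hMS : ∀ (j : ℕ) (E : ℝ), E₀ ≤ E → E < ET → (j : ℝ) + τ ≤ E → ∀ p ∈ Q,
      ∀ x y : ℝ, 0 ≤ singletTermForm z zb w p.1 p.2 E j x y)
    (h12 : 0 ≤ w 1 a₀ + w 2 a₀) (h3 : 0 ≤ w 3 a₀)
    (hXT : 0 ≤ (w 1 a₀ + w 2 a₀) * ((1 - z a₀) * (1 - zb a₀)) ^ φhi
      - apexRest (w 1) z zb a₀ qd qr φlo ET - apexRest (w 2) z zb a₀ qd qr φlo ET)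
    (hYT : 0 ≤ w 3 a₀ * ((1 - z a₀) * (1 - zb a₀)) ^ shi - apexRest (w 3) z zb a₀ qd qr slo ET)
    (hZT : (|w 5 a₀ + w 6 a₀| * ((1 - z a₀) * (1 - zb a₀)) ^ ((φlo + slo) / 2)
            + apexRest (w 5) z zb a₀ qd qr ((φlo + slo) / 2) ET
            + apexRest (w 6) z zb a₀ qd qr ((φlo + slo) / 2) ET) ^ 2 ≤
        4 * ((w 1 a₀ + w 2 a₀) * ((1 - z a₀) * (1 - zb a₀)) ^ φhi
              - apexRest (w 1) z zb a₀ qd qr φlo ET - apexRest (w 2) z zb a₀ qd qr φlo ET) *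
          (w 3 a₀ * ((1 - z a₀) * (1 - zb a₀)) ^ shi - apexRest (w 3) z zb a₀ qd qr slo ET))
    (hMV : ∀ (j : ℕ) (E : ℝ), E₀ ≤ E → E < ET → (j : ℝ) + τ ≤ E → ∀ p ∈ Q,
      0 ≤ oddDomEval z zb (oddWeights w) p.1 (zMono E j))
    (hcV : 0 ≤ w 5 a₀ - w 6 a₀ - |w 4 a₀|)
    (hTV : apexRest (w 5) z zb a₀ qd qr φlo ET + apexRest (w 6) z zb a₀ qd qr φlo ET +
        apexRest (fun k => |w 4 k|) z zb a₀ qd qr φlo ET ≤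
      (w 5 a₀ - w 6 a₀ - |w 4 a₀|) * ((1 - z a₀) * (1 - zb a₀)) ^ φhi)
    (hslo : unitarityBound3D 0 < slo) (hφlo : unitarityBound3D 0 < φlo) (hφ1 : φhi < 1 ∨ 1 < φlo)
    (hτs : τ ≤ slo) (hτφ : τ ≤ φlo) (nS nV : ℕ)
    (hnS : E₀ ≤ slo + ((nS : ℝ) + 1)) (hnV : E₀ ≤ φlo + ((nV : ℝ) + 1))
    (hY : 0 ≤ singletHeadY z zb w 0 slo shi slo shi nS)
    (hXU : 0 ≤ singletHeadX z zb w 0 slo shi φlo φhi nS +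
      vectorHeadNumber z zb w 0 c₁ c₂ φlo φhi φlo φhi nV)
    (hdet : singletHeadZ z zb w 0 slo shi φlo φhi slo shi nS ^ 2 ≤
      4 * (singletHeadX z zb w 0 slo shi φlo φhi nS + vectorHeadNumber z zb w 0 c₁ c₂ φlo φhi φlo φhi nV) *
        singletHeadY z zb w 0 slo shi slo shi nS) :
    ∀ p ∈ Q, (ofPoints z zb w).ExtPositive p.1 p.2 := by
  intro p hp
  obtain ⟨⟨hφ1', hφ2'⟩, ⟨hs1, hs2⟩⟩ := hQ p hp
  have hφ : unitarityBound3D 0 < p.1 := lt_of_lt_of_le hφlo hφ1'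
  have hs : unitarityBound3D 0 < p.2 := lt_of_lt_of_le hslo hs1
  have hp1 : p.1 ≠ 1 := by
    rcases hφ1 with h | h
    · exact ne_of_lt (lt_of_le_of_lt hφ2' h)
    · exact ne_of_gt (lt_of_lt_of_le h hφ1')
  have hlam : 0 < legendreLam 0 := legendreLam_pos 0
  have hb0 := natCast_add_half_le_unitarityBound3D 0
  have hTS := singletTermForm_nonneg_of_apex z zb w hz hzb hord a₀ qd qr hqd hqr hdomd hdomr h12 h3
    hXT hYT hZT
  have hTV' := oddDomEval_nonneg_of_apex z zb (oddWeights w) hz hzb hord a₀ qd qr hqd hqr hdomd hdomr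
    (by simpa only [oddWeights_two, oddWeights_three, oddWeights_four] using hcV)
    (by simpa only [oddWeights_two, oddWeights_three, oddWeights_four] using hTV)
  refine extPositive_ofPoints_of_heads z zb w hz hzb hφ hp1 hs (headSet 0 nS) (headSet 0 nV) ?_ ?_ ?_
  · -- the joint head on the box
    intro x y
    rw [sum_singletTermForm_eq]
    set c : ℕ × ℕ → ℝ := fun q => hrCoeff p.2 0 q.1 q.2 / legendreLam 0 with hc
    set X := ∑ q ∈ headSet 0 nS, c q *
        (pointFunctional (w 1) z zb (crossF p.1 (-1) (zMono (p.2 + (q.1 : ℝ)) q.2)) +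
          pointFunctional (w 2) z zb (crossF p.1 1 (zMono (p.2 + (q.1 : ℝ)) q.2)))
    set Y := ∑ q ∈ headSet 0 nS, c q *
        pointFunctional (w 3) z zb (crossF p.2 (-1) (zMono (p.2 + (q.1 : ℝ)) q.2))
    set W := ∑ q ∈ headSet 0 nS, c q *
        (pointFunctional (w 5) z zb (crossF ((p.1 + p.2) / 2) (-1) (zMono (p.2 + (q.1 : ℝ)) q.2)) +
          pointFunctional (w 6) z zb (crossF ((p.1 + p.2) / 2) 1 (zMono (p.2 + (q.1 : ℝ)) q.2)))
    set U := ∑ q ∈ headSet 0 nV, hrCoeffAB ((p.1 - p.2) / 2) ((p.1 - p.2) / 2) p.1 0 q.1 q.2 /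
        legendreLam 0 * oddDomEval z zb (oddWeights w) p.1 (zMono (p.1 + (q.1 : ℝ)) q.2)
    have hA : ∀ q : ℕ × ℕ, 0 ≤ hrCoeffLo slo shi 0 q.1 q.2 ∧
        hrCoeffLo slo shi 0 q.1 q.2 ≤ hrCoeff p.2 0 q.1 q.2 ∧
        hrCoeff p.2 0 q.1 q.2 ≤ hrCoeffHi slo shi 0 q.1 q.2 :=
      fun q => hrCoeff_mem_Icc_interval hslo hs1 hs2 q.1 q.2
    have hB : ∀ q : ℕ × ℕ, 0 ≤ hrCoeffABLo c₁ c₂ φlo φhi 0 q.1 q.2 ∧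
        hrCoeffABLo c₁ c₂ φlo φhi 0 q.1 q.2 ≤ hrCoeffAB ((p.1 - p.2) / 2) ((p.1 - p.2) / 2) p.1 0 q.1 q.2 ∧
        hrCoeffAB ((p.1 - p.2) / 2) ((p.1 - p.2) / 2) p.1 0 q.1 q.2 ≤ hrCoeffABHi c₁ c₂ φlo φhi 0 q.1 q.2 :=
      fun q => hrCoeffAB_self_mem_Icc_interval hφlo hφ1' hφ2' (hQc p hp).1 (hQc p hp).2 q.1 q.2
    have hEs : ∀ q : ℕ × ℕ, p.2 + (q.1 : ℝ) ∈ Icc (slo + q.1) (shi + q.1) :=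
      fun q => ⟨by linarith, by linarith⟩
    have hEφ : ∀ q : ℕ × ℕ, p.1 + (q.1 : ℝ) ∈ Icc (φlo + q.1) (φhi + q.1) :=
      fun q => ⟨by linarith, by linarith⟩
    -- `X ≥ X_lo/λ₀`
    have hXlo : singletHeadX z zb w 0 slo shi φlo φhi nS / legendreLam 0 ≤ X := by
      rw [singletHeadX, headCellSumI, Finset.sum_div]
      refine Finset.sum_le_sum fun q _ => ?_
      have hΦ : cornerBound₂ (w 1 + w 2) (w 1 - w 2) z zb q.2 (slo + q.1) (shi + q.1) φlo φhi ≤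
          pointFunctional (w 1) z zb (crossF p.1 (-1) (zMono (p.2 + (q.1 : ℝ)) q.2)) +
            pointFunctional (w 2) z zb (crossF p.1 1 (zMono (p.2 + (q.1 : ℝ)) q.2)) :=
        (cornerBound₂_le _ _ z zb hz hzb q.2 (hEs q) (⟨hφ1', hφ2'⟩ : p.1 ∈ Icc φlo φhi)).trans_eq
          (sum45_eq_twoWeightEval _ _ z zb _ _).symm
      have hmin := min_mul_le_mul_of_bounds (hA q).2.1 (hA q).2.2 ((hA q).1.trans (hA q).2.1) hΦ
      have hrw : c q *
          (pointFunctional (w 1) z zb (crossF p.1 (-1) (zMono (p.2 + (q.1 : ℝ)) q.2)) +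
            pointFunctional (w 2) z zb (crossF p.1 1 (zMono (p.2 + (q.1 : ℝ)) q.2))) =
          hrCoeff p.2 0 q.1 q.2 *
            (pointFunctional (w 1) z zb (crossF p.1 (-1) (zMono (p.2 + (q.1 : ℝ)) q.2)) +
              pointFunctional (w 2) z zb (crossF p.1 1 (zMono (p.2 + (q.1 : ℝ)) q.2))) /
              legendreLam 0 := by
        simp only [hc]; ring
      rw [hrw]
      exact div_le_div_of_nonneg_right hmin hlam.le
    -- `Y ≥ Y_lo/λ₀`
    have hYlo : singletHeadY z zb w 0 slo shi slo shi nS / legendreLam 0 ≤ Y := by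
      rw [singletHeadY, headCellSumI, Finset.sum_div]
      refine Finset.sum_le_sum fun q _ => ?_
      have hΦ := termCornerBound_le (w 3) z zb hz hzb q.2 (hEs q) (⟨hs1, hs2⟩ : p.2 ∈ Icc slo shi)
      have hmin := min_mul_le_mul_of_bounds (hA q).2.1 (hA q).2.2 ((hA q).1.trans (hA q).2.1) hΦ
      have hrw : c q * pointFunctional (w 3) z zb (crossF p.2 (-1) (zMono (p.2 + (q.1 : ℝ)) q.2)) =
          hrCoeff p.2 0 q.1 q.2 *
            pointFunctional (w 3) z zb (crossF p.2 (-1) (zMono (p.2 + (q.1 : ℝ)) q.2)) /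
              legendreLam 0 := by
        simp only [hc]; ring
      rw [hrw]
      exact div_le_div_of_nonneg_right hmin hlam.le
    -- `|W| ≤ Z_abs/λ₀`
    have hWabs : |W| ≤ singletHeadZ z zb w 0 slo shi φlo φhi slo shi nS / legendreLam 0 := by
      rw [singletHeadZ, headAbsSumI, Finset.sum_div]
      refine (Finset.abs_sum_le_sum_abs _ _).trans (Finset.sum_le_sum fun q _ => ?_)
      rw [abs_mul, abs_of_nonneg (div_nonneg ((hA q).1.trans (hA q).2.1) hlam.le)]
      have hZq := abs_sum56_le_singletOffDiagAbs z zb w hz hzb q.2 (hEs q)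
        (⟨by linarith, by linarith⟩ :
          (p.1 + p.2) / 2 ∈ Icc ((φlo + slo) / 2) ((φhi + shi) / 2))
      have hZ0 : 0 ≤ singletOffDiagAbs z zb w q.2 (slo + q.1) (shi + q.1) ((φlo + slo) / 2)
          ((φhi + shi) / 2) := (abs_nonneg _).trans hZq
      calc hrCoeff p.2 0 q.1 q.2 / legendreLam 0 * |_|
          ≤ hrCoeff p.2 0 q.1 q.2 / legendreLam 0 *
              singletOffDiagAbs z zb w q.2 (slo + q.1) (shi + q.1) ((φlo + slo) / 2)
                ((φhi + shi) / 2) :=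
            mul_le_mul_of_nonneg_left hZq (div_nonneg ((hA q).1.trans (hA q).2.1) hlam.le)
        _ ≤ hrCoeffHi slo shi 0 q.1 q.2 *
              singletOffDiagAbs z zb w q.2 (slo + q.1) (shi + q.1) ((φlo + slo) / 2)
                ((φhi + shi) / 2) / legendreLam 0 := by
            rw [div_mul_eq_mul_div]
            exact div_le_div_of_nonneg_right (mul_le_mul_of_nonneg_right (hA q).2.2 hZ0) hlam.le
    -- `U ≥ U_lo/λ₀`
    have hUlo : vectorHeadNumber z zb w 0 c₁ c₂ φlo φhi φlo φhi nV / legendreLam 0 ≤ U := by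
      rw [vectorHeadNumber, oddHeadNumber, oddHeadCellSumI, Finset.sum_div]
      refine Finset.sum_le_sum fun q _ => ?_
      have hΦ : cornerBound₂ (fun k => oddWeights w 3 k - oddWeights w 4 k - |oddWeights w 2 k|)
          (fun k => oddWeights w 3 k + oddWeights w 4 k + |oddWeights w 2 k|) z zb q.2
            (φlo + q.1) (φhi + q.1) φlo φhi ≤
          oddDomEval z zb (oddWeights w) p.1 (zMono (p.1 + (q.1 : ℝ)) q.2) := by
        rw [oddDomEval_eq_twoWeightEval]
        exact cornerBound₂_le _ _ z zb hz hzb q.2 (hEφ q) ⟨hφ1', hφ2'⟩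
      have hmin := min_mul_le_mul_of_bounds (hB q).2.1 (hB q).2.2 ((hB q).1.trans (hB q).2.1) hΦ
      have hrw : hrCoeffAB ((p.1 - p.2) / 2) ((p.1 - p.2) / 2) p.1 0 q.1 q.2 / legendreLam 0 *
          oddDomEval z zb (oddWeights w) p.1 (zMono (p.1 + (q.1 : ℝ)) q.2) =
          hrCoeffAB ((p.1 - p.2) / 2) ((p.1 - p.2) / 2) p.1 0 q.1 q.2 *
            oddDomEval z zb (oddWeights w) p.1 (zMono (p.1 + (q.1 : ℝ)) q.2) / legendreLam 0 := by
        ring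
      rw [hrw]
      exact div_le_div_of_nonneg_right hmin hlam.le
    -- the `2×2` argument with `(1,1)` entry `X + U`
    have hXUlo : (singletHeadX z zb w 0 slo shi φlo φhi nS +
        vectorHeadNumber z zb w 0 c₁ c₂ φlo φhi φlo φhi nV) / legendreLam 0 ≤ X + U := by
      rw [add_div]; exact add_le_add hXlo hUlo
    have hXU0 : 0 ≤ (singletHeadX z zb w 0 slo shi φlo φhi nS +
        vectorHeadNumber z zb w 0 c₁ c₂ φlo φhi φlo φhi nV) / legendreLam 0 := div_nonneg hXU hlam.le
    have hY0 : 0 ≤ singletHeadY z zb w 0 slo shi slo shi nS / legendreLam 0 := div_nonneg hY hlam.le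
    have hXUpos : 0 ≤ X + U := hXU0.trans hXUlo
    have hYpos : 0 ≤ Y := hY0.trans hYlo
    have key : 0 ≤ x ^ 2 * (X + U) + y ^ 2 * Y + x * y * W := by
      refine quadForm_nonneg_of_det hXUpos hYpos ?_ x y
      have hW2 : W ^ 2 ≤ (singletHeadZ z zb w 0 slo shi φlo φhi slo shi nS / legendreLam 0) ^ 2 := by
        have h1 : -(singletHeadZ z zb w 0 slo shi φlo φhi slo shi nS / legendreLam 0) ≤ W := by
          linarith [neg_abs_le W]
        exact sq_le_sq' h1 ((le_abs_self W).trans hWabs)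
      have hdet' : (singletHeadZ z zb w 0 slo shi φlo φhi slo shi nS / legendreLam 0) ^ 2 ≤
          4 * ((singletHeadX z zb w 0 slo shi φlo φhi nS +
              vectorHeadNumber z zb w 0 c₁ c₂ φlo φhi φlo φhi nV) / legendreLam 0) *
            (singletHeadY z zb w 0 slo shi slo shi nS / legendreLam 0) := by
        rw [div_pow]
        have hre : 4 * ((singletHeadX z zb w 0 slo shi φlo φhi nS +
              vectorHeadNumber z zb w 0 c₁ c₂ φlo φhi φlo φhi nV) / legendreLam 0) *
            (singletHeadY z zb w 0 slo shi slo shi nS / legendreLam 0) =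
            4 * (singletHeadX z zb w 0 slo shi φlo φhi nS +
              vectorHeadNumber z zb w 0 c₁ c₂ φlo φhi φlo φhi nV) *
              singletHeadY z zb w 0 slo shi slo shi nS / legendreLam 0 ^ 2 := by
          field_simp
        rw [hre]
        exact div_le_div_of_nonneg_right hdet (sq_nonneg _)
      calc W ^ 2 ≤ (singletHeadZ z zb w 0 slo shi φlo φhi slo shi nS / legendreLam 0) ^ 2 := hW2
        _ ≤ 4 * ((singletHeadX z zb w 0 slo shi φlo φhi nS +
              vectorHeadNumber z zb w 0 c₁ c₂ φlo φhi φlo φhi nV) / legendreLam 0) *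
            (singletHeadY z zb w 0 slo shi slo shi nS / legendreLam 0) := hdet'
        _ ≤ 4 * (X + U) * Y :=
            mul_le_mul (mul_le_mul_of_nonneg_left hXUlo (by norm_num)) hYlo hY0
              (mul_nonneg (by norm_num) hXUpos)
    calc (0 : ℝ) ≤ x ^ 2 * (X + U) + y ^ 2 * Y + x * y * W := key
      _ = _ := by ring
  · -- singlet tail at `Δ = Δ_s`
    intro q hq hr x y
    have h2 : (q.2 : ℝ) ≤ (q.1 : ℝ) := by
      have h := hr.2.1
      exact_mod_cast (by omega : q.2 ≤ q.1)
    have hE0 : E₀ ≤ p.2 + (q.1 : ℝ) := (headSet_off hnS q hq hr).trans (by linarith)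
    have hjb : (q.2 : ℝ) + τ ≤ p.2 + (q.1 : ℝ) := by linarith
    have hjE : (q.2 : ℝ) ≤ p.2 + (q.1 : ℝ) := by push_cast at hb0; linarith
    by_cases hET : p.2 + (q.1 : ℝ) < ET
    · exact hMS q.2 _ hE0 hET hjb p hp x y
    · exact hTS _ (not_lt.1 hET) q.2 hjE p.1 ⟨hφ1', hφ2'⟩ p.2 ⟨hs1, hs2⟩ x y
  · -- `V` tail at `Δ = Δ_φ`
    intro q hq hr
    have h2 : (q.2 : ℝ) ≤ (q.1 : ℝ) := by
      have h := hr.2.1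
      exact_mod_cast (by omega : q.2 ≤ q.1)
    have hE0 : E₀ ≤ p.1 + (q.1 : ℝ) := (headSet_off hnV q hq hr).trans (by linarith)
    have hjb : (q.2 : ℝ) + τ ≤ p.1 + (q.1 : ℝ) := by linarith
    have hjE : (q.2 : ℝ) ≤ p.1 + (q.1 : ℝ) := by push_cast at hb0; linarith
    by_cases hET : p.1 + (q.1 : ℝ) < ET
    · exact hMV q.2 _ hE0 hET hjb p hp
    · exact hTV' _ (not_lt.1 hET) q.2 hjE p.1 ⟨hφ1', hφ2'⟩

/-- **The item `ext` of `ArchipelagoObligations`, discharged**: under the hypotheses of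
`extPositive_of_headNumbers` the hypothesis `hext : ∀ p ∈ Q, ExtPositive p.1 p.2` of the point schemas
`boxExcluded_of_archipelagoPointRules` / `boxExcluded_of_archipelagoPointRules₂` holds — so a genuine
island certificate (gaps excluding `s`, `φ`) needs no separate singlet / `V` positivity at the external
point. Restatement for the reader. [cite: KosPolandSimmonsDuffinVichi2015, §2.2 (OPE-coefficient symmetry)] -/
theorem ext_of_headNumbers {N : ℕ} (z zb : Fin N → ℝ) (w : Fin 7 → Fin N → ℝ)
    (hz : ∀ k, z k ∈ Ioo (0 : ℝ) 1) (hzb : ∀ k, zb k ∈ Ioo (0 : ℝ) 1) (hord : ∀ k, zb k ≤ z k)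
    (a₀ : Fin N) (qd qr : Fin N → ℝ) (hqd : ∀ k, 0 < qd k ∧ qd k ≤ 1)
    (hqr : ∀ k, 0 < qr k ∧ qr k ≤ 1)
    (hdomd : ∀ k, z k * zb k ≤ qd k ^ 2 * (z a₀ * zb a₀) ∧ z k ≤ qd k * z a₀)
    (hdomr : ∀ k, (1 - z k) * (1 - zb k) ≤ qr k ^ 2 * (z a₀ * zb a₀) ∧ 1 - zb k ≤ qr k * z a₀)
    {φlo φhi slo shi c₁ c₂ E₀ ET τ : ℝ}
    (hc : ∀ p : ℝ × ℝ, (φlo ≤ p.1 ∧ p.1 ≤ φhi) ∧ (slo ≤ p.2 ∧ p.2 ≤ shi) →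
      c₁ ≤ (p.1 - p.2) / 2 ∧ (p.1 - p.2) / 2 ≤ c₂)
    (hMS : ∀ (j : ℕ) (E : ℝ), E₀ ≤ E → E < ET → (j : ℝ) + τ ≤ E → ∀ p : ℝ × ℝ,
      (φlo ≤ p.1 ∧ p.1 ≤ φhi) ∧ (slo ≤ p.2 ∧ p.2 ≤ shi) →
      ∀ x y : ℝ, 0 ≤ singletTermForm z zb w p.1 p.2 E j x y)
    (h12 : 0 ≤ w 1 a₀ + w 2 a₀) (h3 : 0 ≤ w 3 a₀)
    (hXT : 0 ≤ (w 1 a₀ + w 2 a₀) * ((1 - z a₀) * (1 - zb a₀)) ^ φhi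
      - apexRest (w 1) z zb a₀ qd qr φlo ET - apexRest (w 2) z zb a₀ qd qr φlo ET)
    (hYT : 0 ≤ w 3 a₀ * ((1 - z a₀) * (1 - zb a₀)) ^ shi - apexRest (w 3) z zb a₀ qd qr slo ET)
    (hZT : (|w 5 a₀ + w 6 a₀| * ((1 - z a₀) * (1 - zb a₀)) ^ ((φlo + slo) / 2)
            + apexRest (w 5) z zb a₀ qd qr ((φlo + slo) / 2) ET
            + apexRest (w 6) z zb a₀ qd qr ((φlo + slo) / 2) ET) ^ 2 ≤
        4 * ((w 1 a₀ + w 2 a₀) * ((1 - z a₀) * (1 - zb a₀)) ^ φhi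
              - apexRest (w 1) z zb a₀ qd qr φlo ET - apexRest (w 2) z zb a₀ qd qr φlo ET) *
          (w 3 a₀ * ((1 - z a₀) * (1 - zb a₀)) ^ shi - apexRest (w 3) z zb a₀ qd qr slo ET))
    (hMV : ∀ (j : ℕ) (E : ℝ), E₀ ≤ E → E < ET → (j : ℝ) + τ ≤ E → ∀ p : ℝ × ℝ,
      (φlo ≤ p.1 ∧ p.1 ≤ φhi) ∧ (slo ≤ p.2 ∧ p.2 ≤ shi) →
      0 ≤ oddDomEval z zb (oddWeights w) p.1 (zMono E j))
    (hcV : 0 ≤ w 5 a₀ - w 6 a₀ - |w 4 a₀|)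
    (hTV : apexRest (w 5) z zb a₀ qd qr φlo ET + apexRest (w 6) z zb a₀ qd qr φlo ET +
        apexRest (fun k => |w 4 k|) z zb a₀ qd qr φlo ET ≤
      (w 5 a₀ - w 6 a₀ - |w 4 a₀|) * ((1 - z a₀) * (1 - zb a₀)) ^ φhi)
    (hslo : unitarityBound3D 0 < slo) (hφlo : unitarityBound3D 0 < φlo) (hφ1 : φhi < 1 ∨ 1 < φlo)
    (hτs : τ ≤ slo) (hτφ : τ ≤ φlo) (nS nV : ℕ)
    (hnS : E₀ ≤ slo + ((nS : ℝ) + 1)) (hnV : E₀ ≤ φlo + ((nV : ℝ) + 1))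
    (hY : 0 ≤ singletHeadY z zb w 0 slo shi slo shi nS)
    (hXU : 0 ≤ singletHeadX z zb w 0 slo shi φlo φhi nS +
      vectorHeadNumber z zb w 0 c₁ c₂ φlo φhi φlo φhi nV)
    (hdet : singletHeadZ z zb w 0 slo shi φlo φhi slo shi nS ^ 2 ≤
      4 * (singletHeadX z zb w 0 slo shi φlo φhi nS + vectorHeadNumber z zb w 0 c₁ c₂ φlo φhi φlo φhi nV) *
        singletHeadY z zb w 0 slo shi slo shi nS) :
    ∀ p ∈ {p : ℝ × ℝ | (φlo ≤ p.1 ∧ p.1 ≤ φhi) ∧ (slo ≤ p.2 ∧ p.2 ≤ shi)},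
      (ofPoints z zb w).ExtPositive p.1 p.2 :=
  extPositive_of_headNumbers z zb w hz hzb hord a₀ qd qr hqd hqr hdomd hdomr (fun _ hp => hp)
    (fun p hp => hc p hp) (fun j E h0 hT hj p hp => hMS j E h0 hT hj p hp) h12 h3 hXT hYT hZT
    (fun j E h0 hT hj p hp => hMV j E h0 hT hj p hp) hcV hTV hslo hφlo hφ1 hτs hτφ nS nV hnS hnV hY
    hXU hdet

end ArchipelagoFunctional

end Literature.MathematicalPhysics.QuantumFieldTheory.ONArchipelagoSystem
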